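import Literature.Analysis.FluidPDE.LerayHopfNSRescale
import Literature.Analysis.FluidPDE.ChaeWolfDSSDecayScaling
import HarnessLib

/-!
# Chae–Wolf 2017, Theorem 1.1 — Step 1: asymptotic behaviour in time of the `Lᵖ` norms

Analysis/FluidPDE proofs file (theorems only) on the discharge path of the named fact
`Literature.Analysis.FluidPDE.chaeWolf2017_dss_typeI_decay` (`ChaeWolfRemovingDSS.lean`;
D. Chae, J. Wolf, Comm. PDE 42 (2017) = arXiv:1610.09464, Theorem 1.1). This is **Step 1** of
the printed proof (§2, "1. Asymptotical behavior in time", arXiv p. 5):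

> "We prove that `‖u(t)‖_p^p ≤ λ^{p−3} ‖u‖^p_{L^∞(−λ²,−1;Lᵖ)} (−t)^{(3−p)/2}` for all
> `t ∈ (−∞, 0)` (2.4a). Let `t ∈ (−∞,0)` be arbitrarily chosen. Clearly, there exists a unique
> `k ∈ ℤ` such that `t ∈ [−λ^{2(k+1)}, −λ^{2k})`. Recalling that `u` is `λ`-DSS, we calculate
> `‖u(λ^{−2k}t)‖_p^p = λ^{(p−3)k}‖u(t)‖_p^p`. Since `λ^{−2k}t ∈ [−λ², −1)` and
> `λ^{2k} < −t ≤ λ^{2(k+1)}` we get (2.4a)."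

In `eLpNorm` form (`p`-th roots taken): for a `c`-DSS field `u` (`1 < c`) on `ℝ³` whose `Lᵖ`
norms are bounded by `N` on the period strip `[−c², −1]`, and `3 ≤ p < ∞`,
`‖u(t)‖_{Lᵖ} ≤ c^{1 − 3/p} (−t)^{(3/p − 1)/2} N` for every `t < 0`
(`eLpNorm_le_of_dss_of_strip_bound`). The scaling law behind it is
`‖u(s)‖_{Lᵖ} = γ^{1 − 3/p} ‖u(γ²s)‖_{Lᵖ}` for `γ`-DSS fields
(`eLpNorm_eq_rpow_mul_eLpNorm_sq_mul`, from the tree's `eLpNorm_nsRescaleData_of_ne_zero`).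

## Mathlib / tree search

Tree: `eLpNorm_nsRescaleData_of_ne_zero` (`LerayHopfNSRescale`), `nsRescaleData`,
`IsDiscretelySelfSimilar.zpow` (`ScalingUniformRecurrence`), Step 5 bookkeeping
(`ChaeWolfDSSDecayScaling`). Mathlib: `exists_mem_Ico_zpow`, `Real.rpow_le_rpow_of_nonpos`,
`ENNReal.ofReal_rpow_of_pos`.

## References

* D. Chae, J. Wolf, Comm. PDE 42 (2017) = arXiv:1610.09464, §2, Step 1, (2.4a) (arXiv p. 5).
  [ChaeWolf2017RemovingDSS]
-/

noncomputable section

open MeasureTheory Set Filter Function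
open scoped ENNReal NNReal

namespace Literature.Analysis.FluidPDE

namespace ChaeWolfDecay

variable {F : Type*} [NormedAddCommGroup F] [NormedSpace ℝ F]
variable {u : ℝ → EuclideanSpace ℝ (Fin 3) → F}

/-- A DSS slice is the rescaled datum of the slice one period later:
`u(s) = (u(γ²s))_γ = γ u(γ²s)(γ ·)`. [cite: ChaeWolf2017RemovingDSS, (1.2) (arXiv p. 2)] -/
theorem slice_eq_nsRescaleData {γ : ℝ} (h : IsDiscretelySelfSimilar γ u) (s : ℝ) :
    u s = nsRescaleData γ (u (γ ^ 2 * s)) := by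
  funext x
  have := congrFun (congrFun h s) x
  rw [nsRescale_apply] at this
  rw [nsRescaleData_apply]
  exact this.symm

/-- **The `Lᵖ` scaling law along a DSS field**: `‖u(s)‖_{Lᵖ} = γ (γ⁻³)^{1/p} ‖u(γ²s)‖_{Lᵖ}`
(`γ > 0`; the factor is `γ^{1 − 3/p}`), from `u(s) = γ u(γ²s)(γ·)` and the scaling of `Lᵖ(ℝ³)`
norms (Chae–Wolf 2017, the computation `‖u(λ^{−2k}t)‖_p^p = λ^{(p−3)k}‖u(t)‖_p^p` of Step 1).
[cite: ChaeWolf2017RemovingDSS, §2 Step 1 (arXiv p. 5)] -/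
theorem eLpNorm_eq_mul_eLpNorm_sq_mul {γ : ℝ} (hγ : 0 < γ) (h : IsDiscretelySelfSimilar γ u)
    (p : ℝ≥0∞) (s : ℝ) :
    eLpNorm (u s) p volume =
      ENNReal.ofReal γ * ENNReal.ofReal ((γ ^ 3)⁻¹) ^ (1 / p).toReal *
        eLpNorm (u (γ ^ 2 * s)) p volume := by
  rw [slice_eq_nsRescaleData h s, eLpNorm_nsRescaleData_of_ne_zero p _ hγ.ne',
    finrank_euclideanSpace_fin, Real.enorm_eq_ofReal hγ.le, abs_of_pos (by positivity)]

/-- The scaling factor in real form: `γ (γ⁻³)^{1/p} = γ^{1 − 3/p}` for `γ > 0` (as an `ℝ≥0∞`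
identity with `ENNReal.ofReal`; for `p ∈ {0, ∞}` both sides are `γ` by the junk conventions). [folklore] -/
theorem ofReal_mul_ofReal_rpow_eq {γ : ℝ} (hγ : 0 < γ) (p : ℝ≥0∞) :
    ENNReal.ofReal γ * ENNReal.ofReal ((γ ^ 3)⁻¹) ^ (1 / p).toReal =
      ENNReal.ofReal (γ ^ (1 - 3 / p.toReal)) := by
  have h1 : (1 / p).toReal = 1 / p.toReal := by
    rw [one_div, ENNReal.toReal_inv, one_div]
  rw [h1, ENNReal.ofReal_rpow_of_pos (by positivity), ← ENNReal.ofReal_mul hγ.le]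
  congr 1
  have e1 : (γ ^ 3)⁻¹ = γ ^ (-3 : ℝ) := by
    rw [Real.rpow_neg hγ.le]
    show (γ ^ 3)⁻¹ = (γ ^ ((3 : ℕ) : ℝ))⁻¹
    rw [Real.rpow_natCast]
  rw [e1, ← Real.rpow_mul hγ.le]
  conv_lhs => rw [show γ = γ ^ (1 : ℝ) from (Real.rpow_one γ).symm]
  rw [← Real.rpow_mul hγ.le, ← Real.rpow_add hγ]
  congr 1
  ring

/-- **(2.4a), `eLpNorm` form: the asymptotic behaviour in time of the `Lᵖ` norms of a DSS
field.** Let `u : ℝ → ℝ³ → F` be `c`-discretely self-similar, `1 < c`, let `3 ≤ p < ∞`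
(`p : ℝ≥0∞`, `3 ≤ p`, `p ≠ ∞`), and suppose `‖u(s)‖_{Lᵖ} ≤ N` for all `s` in the period strip
`[−c², −1]`. Then for every `t < 0`,
`‖u(t)‖_{Lᵖ} ≤ c^{1 − 3/p} (−t)^{(3/p − 1)/2} N` (Chae–Wolf 2017, (2.4a):
"`‖u(t)‖_p^p ≤ λ^{p−3} ‖u‖^p_{L^∞(−λ²,−1;Lᵖ)} (−t)^{(3−p)/2}`"; here with `p`-th roots taken,
for possibly infinite `N`). Proof as printed: `t = γ⁻²s` with `s ∈ [−c², −1]`, `γ = c⁻ᵐ`,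
`(c²)ᵐ ≤ −t < (c²)^{m+1}`; the scaling law gives `‖u(t)‖ = γ^{1−3/p}‖u(s)‖` and
`γ^{1−3/p} = ((c²)ᵐ)^{(3/p−1)/2} ≤ (−t/c²)^{(3/p−1)/2}` as the exponent is `≤ 0`.
[cite: ChaeWolf2017RemovingDSS, §2 Step 1, (2.4a) (arXiv p. 5)] -/
theorem eLpNorm_le_of_dss_of_strip_bound {c : ℝ} (hc : 1 < c) (h : IsDiscretelySelfSimilar c u)
    {p : ℝ≥0∞} (hp3 : 3 ≤ p) (hpt : p ≠ ⊤) {N : ℝ≥0∞}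
    (hN : ∀ s ∈ Icc (-c ^ 2) (-1), eLpNorm (u s) p volume ≤ N) {t : ℝ} (ht : t < 0) :
    eLpNorm (u t) p volume ≤
      ENNReal.ofReal (c ^ (1 - 3 / p.toReal) * (-t) ^ ((3 / p.toReal - 1) / 2)) * N := by
  have hc0 : 0 < c := one_pos.trans hc
  have hc2 : 1 < c ^ 2 := by nlinarith
  have hq3 : 3 ≤ p.toReal := by
    have := ENNReal.toReal_mono hpt hp3
    simpa using this
  have hq : 0 < p.toReal := by linarith
  have hexp : (3 / p.toReal - 1) / 2 ≤ 0 := by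
    have : 3 / p.toReal ≤ 1 := (div_le_one hq).2 hq3
    linarith
  -- carry `t` into the strip
  have hnt : 0 < -t := neg_pos.2 ht
  obtain ⟨m, hm1, hm2⟩ := exists_mem_Ico_zpow hnt hc2
  have hg0 : 0 < (c ^ 2) ^ m := zpow_pos (by positivity) m
  set γ : ℝ := c ^ (-m) with hγ
  have hγ0 : 0 < γ := zpow_pos hc0 _
  have hγsq : γ ^ 2 = ((c ^ 2) ^ m)⁻¹ := by
    rw [hγ, zpow_neg, inv_pow, ← zpow_natCast (c ^ m) 2, ← zpow_mul, mul_comm, zpow_mul,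
      zpow_natCast]
  have hs : γ ^ 2 * t ∈ Icc (-c ^ 2) (-1) := by
    rw [hγsq]
    constructor
    · rw [zpow_add_one₀ (by positivity) m] at hm2
      rw [inv_mul_eq_div, le_div_iff₀ hg0]
      nlinarith
    · rw [inv_mul_eq_div, div_le_iff₀ hg0]
      nlinarith
  -- the scaling law between `t` and `s = γ² t`
  have hγdss : IsDiscretelySelfSimilar γ u := h.zpow hc0.ne' (-m)
  rw [eLpNorm_eq_mul_eLpNorm_sq_mul hγ0 hγdss p t, ofReal_mul_ofReal_rpow_eq hγ0 p]
  refine mul_le_mul' (ENNReal.ofReal_le_ofReal ?_) (hN _ hs)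
  -- `γ^{1-3/q} = ((c²)^m)^{(3/q-1)/2} ≤ (-t/c²)^{(3/q-1)/2} = c^{1-3/q} (-t)^{(3/q-1)/2}`
  have e1 : γ ^ (1 - 3 / p.toReal) = ((c ^ 2) ^ m) ^ ((3 / p.toReal - 1) / 2) := by
    have hγ' : γ = ((c ^ 2) ^ m) ^ (-(1 / 2 : ℝ)) := by
      rw [Real.rpow_neg hg0.le, ← Real.sqrt_eq_rpow, ← Real.sqrt_inv, ← hγsq, Real.sqrt_sq hγ0.le]
    rw [hγ', ← Real.rpow_mul hg0.le]
    congr 1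
    ring
  have hbase : -t / c ^ 2 ≤ (c ^ 2) ^ m := by
    rw [zpow_add_one₀ (by positivity) m] at hm2
    rw [div_le_iff₀ (by positivity)]
    linarith
  have hbase0 : 0 < -t / c ^ 2 := by positivity
  calc γ ^ (1 - 3 / p.toReal) = ((c ^ 2) ^ m) ^ ((3 / p.toReal - 1) / 2) := e1
    _ ≤ (-t / c ^ 2) ^ ((3 / p.toReal - 1) / 2) :=
        Real.rpow_le_rpow_of_nonpos hbase0 hbase hexp
    _ = c ^ (1 - 3 / p.toReal) * (-t) ^ ((3 / p.toReal - 1) / 2) := by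
        rw [Real.div_rpow hnt.le (by positivity), div_eq_mul_inv, mul_comm]
        congr 1
        rw [← Real.rpow_natCast c 2, ← Real.rpow_mul hc0.le, ← Real.rpow_neg hc0.le]
        congr 1
        push_cast
        ring

end ChaeWolfDecay

end Literature.Analysis.FluidPDE

end
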